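import Literature.RepresentationTheory.BorelWallach2000.UpqCasimirTensor   -- ★ `upqPBasis`, `upqFrame`, `upq_real_smul_upqUnit`, `upqUnit_add`, `upqRe`, `upqIm`
import Mathlib.Analysis.Matrix.Normed
import HarnessLib

/-!
# The Cartan split `Z = Z_𝔨 + Σ_s c_s x_s` of `𝔲(α, β)` with EXPLICIT coefficient and norm bounds

Topic `NumberTheory/Automorphic`; namespace `Literature.NumberTheory.Automorphic`; THEOREMS ONLY (no `def`, no named fact, no instance declaration, no notation,
no `sorry`).  Cell `hodgecm-mathlib`, F0∕P3, T1a arch line, ROAD-GLOB (A6 #92 at `U(2,1)`), brick «FB», piece **T4c-ii-a** (A-p06 (g24) plan 2026-08-31):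
★ `upq_exists_kInLie_add_sum_upqPBasis` splits `Z ∈ 𝔤` as `k + Σ_s c_s x_s` (`k ∈ 𝔨`, `(x_s)` the Cartan frame of `𝔭`); THIS file re-derives the split with the
explicit coefficients `c_{(p,0)} = Re Z_p + Im Z_p`, `c_{(p,1)} = Re Z_p − Im Z_p` (`Z_p` the `(a,b)` entry of the `𝔭`-block) and records the bounds the factorial
estimate needs, in the `L^∞`-operator norm of ★ `GKModules` (H3): `|c_s| ≤ 2 ‖Z‖` and `‖k‖ ≤ (1 + 2 Σ_s ‖x_s‖) · ‖Z‖` (crude triangle bound; constants are immaterial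
for (FB)).  [BorelWallach2000, II §1.1 (3), §4.2]; [Knapp2002, VI §2 (Cartan decomposition)].
HONEST LABEL: closes no registered stub by itself.  HC_CM is proved only modulo the 2 remaining named inputs (hLiu418, h413) until rung 0 closes.

## References
* A. Borel, N. Wallach, *Continuous cohomology, discrete subgroups, and representations of reductive groups*, 2nd ed. (2000), II §1.1, §4.2 [BorelWallach2000].
* A. W. Knapp, *Lie Groups Beyond an Introduction*, 2nd ed. (2002), VI §2 [Knapp2002].
-/

set_option autoImplicit false

noncomputable section

namespace Literature.NumberTheory.Automorphic

open scoped Matrix ComplexConjugate Matrix.Norms.Operator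
open Literature.RepresentationTheory.KonnoKonno2007 Literature.RepresentationTheory.KonnoKonno2007.RealDualPair
open Literature.RepresentationTheory.BorelWallach2000

variable {α β : Type} [Fintype α] [DecidableEq α] [Fintype β] [DecidableEq β]

/-- An entry is bounded by the `L^∞`-operator norm: `‖M i j‖ ≤ ‖M‖` (local copy of ★ `norm_entry_le_linfty_opNorm` of
`ArchRankinSelbergOfTorusKirillov`, kept private to avoid that heavy import). [folklore] [cite: Knapp2002, VI §2] -/
private theorem norm_entry_le_linfty_opNorm' {m n : Type} [Fintype m] [Fintype n] (M : Matrix m n ℂ) (i : m) (j : n) : ‖M i j‖ ≤ ‖M‖ := by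
  have h : ‖M i j‖₊ ≤ ‖M‖₊ := by
    rw [Matrix.linfty_opNNNorm_def]
    exact le_trans (Finset.single_le_sum (f := fun j => ‖M i j‖₊) (fun _ _ => zero_le) (Finset.mem_univ j))
      (Finset.le_sup (f := fun i => ∑ j, ‖M i j‖₊) (Finset.mem_univ i))
  exact_mod_cast h

/-- **THE CARTAN SPLIT WITH BOUNDS.**  Every `Z ∈ 𝔲(α, β)` is `k + Σ_s c_s x_s` with `k ∈ 𝔨`, `|c_s| ≤ 2 ‖Z‖` and `‖k‖ ≤ (1 + 2 Σ_s ‖x_s‖) ‖Z‖`.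
[cite: BorelWallach2000, II §1.1 (3), §4.2] [cite: Knapp2002, VI §2] -/
theorem upq_exists_kInLie_add_sum_upqPBasis_bound (Z : (uFormGroup α β).lie) :
    ∃ k ∈ (uFormGroup α β).kInLie, ∃ c : (α × β) × Fin 2 → ℝ, Z = k + ∑ s, c s • upqPBasis s ∧
      (∀ s, |c s| ≤ 2 * ‖(Z : Matrix (α ⊕ β) (α ⊕ β) ℂ)‖) ∧
      ‖(k : Matrix (α ⊕ β) (α ⊕ β) ℂ)‖ ≤
        (1 + 2 * ∑ s : (α × β) × Fin 2, ‖((upqPBasis s : (uFormGroup α β).lie) : Matrix (α ⊕ β) (α ⊕ β) ℂ)‖) * ‖(Z : Matrix (α ⊕ β) (α ⊕ β) ℂ)‖ := by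
  -- the explicit coefficients of ★ `upq_exists_kInLie_add_sum_upqPBasis`
  set c : (α × β) × Fin 2 → ℝ := fun s => if s.2 = 0 then upqRe s.1 Z + upqIm s.1 Z else upqRe s.1 Z - upqIm s.1 Z with hc
  have hsum : ∑ s, c s • upqPBasis s =
      ∑ p : α × β, ((upqFrame α β).ξ p Z • (upqFrame α β).x p + (upqFrame α β).η p Z • (upqFrame α β).y p) := by
    rw [Fintype.sum_prod_type]
    refine Finset.sum_congr rfl fun p _ => ?_
    rw [Fin.sum_univ_two]
    change c (p, 0) • upqUnit p (upqPCoeff 0) + c (p, 1) • upqUnit p (upqPCoeff 1) =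
      upqRe p Z • upqUnit p 1 + ((2 : ℝ) • upqIm p) Z • upqUnit p (Complex.I / 2)
    rw [LinearMap.smul_apply, upq_real_smul_upqUnit, upq_real_smul_upqUnit, upq_real_smul_upqUnit,
      upq_real_smul_upqUnit, upqUnit_add, upqUnit_add]
    congr 1
    simp only [hc, upqPCoeff, Fin.isValue, ↓reduceIte, one_ne_zero, smul_eq_mul]
    push_cast
    ring
  have hk : Z - ∑ s, c s • upqPBasis s ∈ (uFormGroup α β).kInLie := by rw [hsum]; exact (upqFrame α β).decomp Z
  -- coefficient bound
  have hcb : ∀ s, |c s| ≤ 2 * ‖(Z : Matrix (α ⊕ β) (α ⊕ β) ℂ)‖ := by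
    intro s
    have hentry := norm_entry_le_linfty_opNorm' (Z : Matrix (α ⊕ β) (α ⊕ β) ℂ) (Sum.inl s.1.1) (Sum.inr s.1.2)
    have hre : |((Z : Matrix (α ⊕ β) (α ⊕ β) ℂ) (Sum.inl s.1.1) (Sum.inr s.1.2)).re| ≤ ‖(Z : Matrix (α ⊕ β) (α ⊕ β) ℂ)‖ :=
      (Complex.abs_re_le_norm _).trans hentry
    have him : |((Z : Matrix (α ⊕ β) (α ⊕ β) ℂ) (Sum.inl s.1.1) (Sum.inr s.1.2)).im| ≤ ‖(Z : Matrix (α ⊕ β) (α ⊕ β) ℂ)‖ :=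
      (Complex.abs_im_le_norm _).trans hentry
    rw [hc]
    simp only [upqRe_apply, upqIm_apply]
    split_ifs
    · exact (abs_add_le _ _).trans (by linarith)
    · exact (abs_sub _ _).trans (by linarith)
  refine ⟨Z - ∑ s, c s • upqPBasis s, hk, c, (sub_add_cancel _ _).symm, hcb, ?_⟩
  -- norm of `k = Z − Σ c_s x_s`
  rw [AddSubgroupClass.coe_sub, AddSubmonoidClass.coe_finsetSum]
  simp only [SetLike.val_smul]
  calc ‖(Z : Matrix (α ⊕ β) (α ⊕ β) ℂ) - ∑ s, c s • ((upqPBasis s : (uFormGroup α β).lie) : Matrix (α ⊕ β) (α ⊕ β) ℂ)‖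
      ≤ ‖(Z : Matrix (α ⊕ β) (α ⊕ β) ℂ)‖ + ‖∑ s, c s • ((upqPBasis s : (uFormGroup α β).lie) : Matrix (α ⊕ β) (α ⊕ β) ℂ)‖ := norm_sub_le _ _
    _ ≤ ‖(Z : Matrix (α ⊕ β) (α ⊕ β) ℂ)‖ + ∑ s, ‖c s • ((upqPBasis s : (uFormGroup α β).lie) : Matrix (α ⊕ β) (α ⊕ β) ℂ)‖ := by
        gcongr; exact norm_sum_le _ _
    _ ≤ ‖(Z : Matrix (α ⊕ β) (α ⊕ β) ℂ)‖ + ∑ s, 2 * ‖(Z : Matrix (α ⊕ β) (α ⊕ β) ℂ)‖ * ‖((upqPBasis s : (uFormGroup α β).lie) : Matrix (α ⊕ β) (α ⊕ β) ℂ)‖ := by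
        gcongr with s
        rw [norm_smul, Real.norm_eq_abs]
        exact mul_le_mul_of_nonneg_right (hcb s) (norm_nonneg _)
    _ = (1 + 2 * ∑ s : (α × β) × Fin 2, ‖((upqPBasis s : (uFormGroup α β).lie) : Matrix (α ⊕ β) (α ⊕ β) ℂ)‖) * ‖(Z : Matrix (α ⊕ β) (α ⊕ β) ℂ)‖ := by
        rw [add_mul, one_mul, Finset.mul_sum, Finset.sum_mul]
        congr 1
        exact Finset.sum_congr rfl fun s _ => by ring

end Literature.NumberTheory.Automorphic

end
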